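import Summits.QuantumFields.YangMills.Theorems.BalabanLadderIROddTorusTypSmallAction
import Literature.MathematicalPhysics.QuantumLattice.BalabanRG
import HarnessLib

/-!
# The ball-sparse small-field typicality factor `Typ_bs` and its torus anchor (clause (iii_T))

Support file (seat ym-infvol-p3, fleet R136 (i); crux `IR` = stmt-QuantumFields-19354, registered line «af-pincer-T»,
format `TypShellCond ρ β b n ε δ`; count-neutral helper).  The line's card (rev 4 §T) names as intended witness of the
existential `Typ` the working class `Typ⋆(c) = Typ_bs(c) ∩ Typ_hol(c) [∩ Typ_flux(c)]`, read on the cell's own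
plaquettes `cellPlaqs w c`.  Its LARGE-FIELD factor is the **ball-sparse small-field class**
`typBallSparse ρ w t₀ R D c = {U | ∃ X ⊆ cellPlaqs w c, IsBallSparse R D X ∧ U ∈ smallFieldRegion ρ (cellPlaqs w c \ X) t₀}`
(typed by the crux-plan seat ym-cplan-19354-af-pincer g5, `Sketch-g5-testclass.lean` §E, with its format conjuncts
`typBallSparse_dependsOn` / `measurableSet_typBallSparse` — §1 is that §E, landed as a tree module).  The card records
the torus supplier of its clause (iii_T) as «union bound over balls and `(D+1)`-subsets against the chessboard gain —
arithmetic [heur], decls [lean]»; this file makes the arithmetic [lean]: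

* §2 the CHOICE SET `ballChoices w R D c` (the `(D+1)`-subsets of `cellPlaqs w c` within sup-distance `2R` of one of
  their members), `exists_mem_ballChoices_of_notMem` (an atypical configuration has `D+1` LARGE-field plaquettes forming
  a member of the choice set), `card_ballChoices_le`: `#ballChoices ≤ (2b)⁴ m · ((4R+1)⁴ m)^(D+1)` (`m = 6` orientations);
* §3 **`torusAnchor_typBallSparse`** — clause (iii_T) for `Typ := typBallSparse ρ w t₀ R D` on every odd torus
  `2S+1 ≥ 4b`: `μ_{2S+1,β} {V | ∀ c ∈ F, torusLift V ∉ Typ_bs c} ≤ ofReal (δ_bs ^ #F)`,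
  `δ_bs = (2b)⁴ m · ((4R+1)⁴ m)^(D+1) · m · exp (-λ t₀ (D+1) / m² + (D+1) (K₀ + D₁ log β) / m)`, `0 ≤ λ ≤ β` free,
  `K₀, D₁` the volume-free constants of `measureReal_forall_le_cellAction_le_pow_rep` (union over `F.pi ballChoices`
  of the hereditary chessboard rarity).  With the card's scales `(t₀, R, D) = (K log β / β, β, A β)`, `λ = β/2` the
  base is `36 (2b)⁴ (6 (4β+1)⁴ e^{K₀/6} β^{D₁/6 - K/72})^{Aβ+1}` — the asymptotics are the lead's.

NOT covered (honest): clause (ii_T) for `Typ_bs` (kernel-level rarity at SMALL thresholds — the LDP debt of record,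
owner R37 (b)); the composition of torus-level budgets across different factors (they do not add by logic alone, unlike
the sup-`ζ` kernel budgets of `IRTypAlgebra`); clause (i_T).  HONEST FRAMING: finite-torus Peierls–chessboard
bookkeeping for ONE `Typ` factor of a registered line of a CONDITIONAL chain; nothing here bears on the mass gap or Clay.
-/


noncomputable section

open MeasureTheory Finset
open Literature.MathematicalPhysics
open Literature.MathematicalPhysics.QuantumFieldTheory Literature.MathematicalPhysics.QuantumLattice
open Summit.QuantumFields.YangMills.Cruxes.IR.Tempered (cellEdges)

namespace Summit.QuantumFields.YangMills.Theorems.OddTorusChessboard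

variable {G : Type} [Group G] [TopologicalSpace G] [IsTopologicalGroup G] [CompactSpace G]
  [MeasurableSpace G] [BorelSpace G]

/-! ### §1. The ball-sparse small-field class (crux-plan seat ym-cplan-19354-af-pincer g5, Sketch-g5 §E, verbatim) -/

section BallSparse

variable {N : ℕ} (ρ : G →* Matrix (Fin N) (Fin N) ℂ)

omit [TopologicalSpace G] [IsTopologicalGroup G] [CompactSpace G] [MeasurableSpace G] [BorelSpace G] in
/-- A plaquette read by the cell has its four edges among the cell's edges. -/
theorem plaquetteEdges_subset_of_mem_cellPlaqs {w : Fin 4 → ℤ → ℤ} {c : Fin 4 → ℤ} {q : ZdPlaquette 4}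
    (hq : q ∈ cellPlaqs w c) : plaquetteEdges q ⊆ cellEdges w c := by
  obtain ⟨hq1, hqi, hqj⟩ : q.1 ∈ cellSites w c ∧ q.1 + Pi.single q.2.1.1 1 ∈ cellSites w c ∧
      q.1 + Pi.single q.2.1.2 1 ∈ cellSites w c :=
    ⟨fst_mem_cellSites_of_mem_cellPlaqs hq, (Finset.mem_filter.1 hq).2⟩
  have hE : ∀ x ∈ cellSites w c, ∀ k : Fin 4, ((x, k) : QuantumLattice.ZdEdge 4) ∈ cellEdges w c :=
    fun x hx k => Finset.mem_product.2 ⟨hx, Finset.mem_univ _⟩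
  intro e he
  simp only [plaquetteEdges, Finset.mem_insert, Finset.mem_singleton] at he
  rcases he with rfl | rfl | rfl | rfl
  · exact hE _ hq1 _
  · exact hE _ hqi _
  · exact hE _ hqj _
  · exact hE _ hq1 _

/-- **`R`-ball sparseness with multiplicity `D`** of an exceptional plaquette set `X`: every sup-norm ball of radius
`R` (on base points, centred anywhere in `ℤ⁴`) meets `X` in at most `D` plaquettes.  Card rev 4 §T scales:
`(t₀, R, D) = (K log β / β, β, A β)` (or the β-dilute / multiscale variants of cruxidea-7 (C-b)). -/
def IsBallSparse (R D : ℕ) (X : Finset (ZdPlaquette 4)) : Prop :=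
  ∀ x : Literature.Probability.LatticeModels.Site 4, #(X.filter fun p => ∀ i, |p.1 i - x i| ≤ (R : ℤ)) ≤ D

/-- **The ball-sparse small-field class of a cell** `Typ_bs(c; t₀, R, D)`: off an `R`-ball-sparse exceptional set
`X ⊆ cellPlaqs w c` of multiplicity `≤ D`, every plaquette read by the cell is `t₀`-small-field in the tree's sense
(`smallFieldRegion`, `N - Re tr ρ(U_p) ≤ t₀`).  The LARGE-FIELD component of the working class
`Typ⋆ = Typ_bs ∩ Typ_hol [∩ Typ_flux]` of card rev 4 §T of line «af-pincer-T» (ctriage-2 S-T1 «ball-sparse»).  Sibling: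
`smallActionTyp ρ w T c` (cell action `< T`, an ℓ¹ event, torus anchor `torusAnchor_smallActionTyp`); `Typ_bs` is the
ℓ^∞-off-a-sparse-set event, torus anchor `torusAnchor_typBallSparse` below. -/
def typBallSparse (w : Fin 4 → ℤ → ℤ) (t₀ : ℝ) (R D : ℕ) (c : Fin 4 → ℤ) : Set (LGConfig 4 G) :=
  {U | ∃ X : Finset (ZdPlaquette 4), X ⊆ cellPlaqs w c ∧ IsBallSparse R D X ∧
      U ∈ smallFieldRegion ρ (↑(cellPlaqs w c \ X) : Set (ZdPlaquette 4)) t₀}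

omit [TopologicalSpace G] [IsTopologicalGroup G] [CompactSpace G] [MeasurableSpace G] [BorelSpace G] in
/-- Plaquette holonomies agree for configurations agreeing on the plaquette's four edges. -/
theorem plaquetteHolonomyZd_congr {U V : LGConfig 4 G} (p : ZdPlaquette 4)
    (h : ∀ e ∈ plaquetteEdges p, U e = V e) :
    plaquetteHolonomyZd U p.1 p.2.1.1 p.2.1.2 = plaquetteHolonomyZd V p.1 p.2.1.1 p.2.1.2 := by
  have h1 := h (p.1, p.2.1.1) (by simp [plaquetteEdges])
  have h2 := h (p.1 + Pi.single p.2.1.1 1, p.2.1.2) (by simp [plaquetteEdges])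
  have h3 := h (p.1 + Pi.single p.2.1.2 1, p.2.1.1) (by simp [plaquetteEdges])
  have h4 := h (p.1, p.2.1.2) (by simp [plaquetteEdges])
  simp only [plaquetteHolonomyZd, h1, h2, h3, h4]

omit [TopologicalSpace G] [IsTopologicalGroup G] [CompactSpace G] [MeasurableSpace G] [BorelSpace G] in
/-- Membership in `Typ_bs(c)` transfers between configurations agreeing on `cellEdges w c`. -/
theorem mem_typBallSparse_of_agree {w : Fin 4 → ℤ → ℤ} {t₀ : ℝ} {R D : ℕ} {c : Fin 4 → ℤ} {U V : LGConfig 4 G}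
    (hUV : ∀ e ∈ (↑(cellEdges w c) : Set (QuantumLattice.ZdEdge 4)), U e = V e)
    (hU : U ∈ typBallSparse ρ w t₀ R D c) :
    V ∈ typBallSparse ρ w t₀ R D c := by
  obtain ⟨X, hX, hsp, hsf⟩ := hU
  refine ⟨X, hX, hsp, fun p hp => ?_⟩
  have hp' : p ∈ cellPlaqs w c := (Finset.mem_sdiff.1 (Finset.mem_coe.1 hp)).1
  have hcongr := plaquetteHolonomyZd_congr (U := U) (V := V) p (fun e he => hUV e
    (Finset.mem_coe.2 (plaquetteEdges_subset_of_mem_cellPlaqs hp' he)))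
  have := hsf p hp
  simp only [plaquetteObs] at this ⊢
  rw [← hcongr]
  exact this

omit [TopologicalSpace G] [IsTopologicalGroup G] [CompactSpace G] [MeasurableSpace G] [BorelSpace G] in
/-- **(second conjunct of `TypShellCond` for this factor)** `Typ_bs(c)` is read off the cell's own edges. -/
theorem typBallSparse_dependsOn (w : Fin 4 → ℤ → ℤ) (t₀ : ℝ) (R D : ℕ) (c : Fin 4 → ℤ) :
    DependsOn (fun U : LGConfig 4 G => U ∈ typBallSparse ρ w t₀ R D c) ↑(cellEdges w c) := by
  intro U V hUV
  show (U ∈ typBallSparse ρ w t₀ R D c) = (V ∈ typBallSparse ρ w t₀ R D c)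
  exact propext ⟨mem_typBallSparse_of_agree ρ hUV, mem_typBallSparse_of_agree ρ fun e he => (hUV e he).symm⟩

omit [TopologicalSpace G] [IsTopologicalGroup G] [CompactSpace G] [MeasurableSpace G] [BorelSpace G] in
/-- Non-vacuity: the trivial configuration is ball-sparse-typical for every `t₀ ≥ 0` (`X = ∅`). -/
theorem one_mem_typBallSparse (w : Fin 4 → ℤ → ℤ) {t₀ : ℝ} (ht₀ : 0 ≤ t₀) (R D : ℕ) (c : Fin 4 → ℤ) :
    (1 : LGConfig 4 G) ∈ typBallSparse ρ w t₀ R D c :=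
  ⟨∅, Finset.empty_subset _, fun x => by simp, one_mem_smallFieldRegion ρ _ ht₀⟩

omit [TopologicalSpace G] [IsTopologicalGroup G] [CompactSpace G] [MeasurableSpace G] [BorelSpace G] in
/-- `Typ_bs` is monotone in the threshold and in the multiplicity. -/
theorem typBallSparse_mono (w : Fin 4 → ℤ → ℤ) {t₀ t₀' : ℝ} (ht : t₀ ≤ t₀') {R D D' : ℕ} (hD : D ≤ D')
    (c : Fin 4 → ℤ) : typBallSparse ρ w t₀ R D c ⊆ typBallSparse (G := G) ρ w t₀' R D' c := by
  rintro U ⟨X, hX, hsp, hsf⟩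
  exact ⟨X, hX, fun x => (hsp x).trans hD, smallFieldRegion_mono ρ ht hsf⟩

omit [TopologicalSpace G] [IsTopologicalGroup G] [CompactSpace G] [MeasurableSpace G] [BorelSpace G] in
/-- The small-field region over a FINITE plaquette set is a finite intersection of sub-level sets. -/
theorem smallFieldRegion_coe_eq_biInter (S : Finset (ZdPlaquette 4)) (ε : ℝ) :
    smallFieldRegion (G := G) ρ (↑S : Set (ZdPlaquette 4)) ε =
      ⋂ p ∈ S, {U : LGConfig 4 G | (N : ℝ) - plaquetteObs ρ p.1 p.2.1.1 p.2.1.2 U ≤ ε} := by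
  ext U
  simp [smallFieldRegion, Set.mem_iInter]

omit [CompactSpace G] in
open Classical in
/-- **(first conjunct of `TypShellCond` for this factor)** (continuous `ρ`, second-countable `G`): `Typ_bs(c)` is a
finite union over the admissible exceptional sets of finite intersections of closed sub-level sets. -/
theorem measurableSet_typBallSparse [SecondCountableTopology G] (hρ : Continuous ρ) (w : Fin 4 → ℤ → ℤ) (t₀ : ℝ)
    (R D : ℕ) (c : Fin 4 → ℤ) : MeasurableSet (typBallSparse (G := G) ρ w t₀ R D c) := by
  have hrepr : typBallSparse (G := G) ρ w t₀ R D c =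
      ⋃ X ∈ (cellPlaqs w c).powerset.filter (fun X => IsBallSparse R D X),
        smallFieldRegion ρ (↑(cellPlaqs w c \ X) : Set (ZdPlaquette 4)) t₀ := by
    ext U
    simp only [typBallSparse, Set.mem_setOf_eq, Set.mem_iUnion, Finset.mem_filter, Finset.mem_powerset,
      exists_prop, and_assoc]
  rw [hrepr]
  refine Finset.measurableSet_biUnion _ fun X _ => ?_
  rw [smallFieldRegion_coe_eq_biInter]
  exact Finset.measurableSet_biInter _ fun p _ =>
    measurableSet_le (measurable_const.sub (measurable_plaquetteObs ρ hρ p.1 p.2.1.1 p.2.1.2)) measurable_const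

end BallSparse

/-! ### §2. The choice set of an atypical cell and its cardinality -/

section Choices

variable {N : ℕ} (ρ : G →* Matrix (Fin N) (Fin N) ℂ)

/-- The plaquettes of the cell whose base points lie in the sup-ball of radius `2R` around the base point of `q₀`. -/
def nearPlaqs (w : Fin 4 → ℤ → ℤ) (R : ℕ) (c : Fin 4 → ℤ) (q₀ : ZdPlaquette 4) : Finset (ZdPlaquette 4) :=
  (cellPlaqs w c).filter fun p => ∀ i, |p.1 i - q₀.1 i| ≤ 2 * (R : ℤ)

/-- **The choice set** of the union bound: the `(D+1)`-element subsets of `cellPlaqs w c` lying in the `2R`-sup-ball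
of one of the cell's plaquettes. -/
def ballChoices (w : Fin 4 → ℤ → ℤ) (R D : ℕ) (c : Fin 4 → ℤ) : Finset (Finset (ZdPlaquette 4)) :=
  (cellPlaqs w c).biUnion fun q₀ => (nearPlaqs w R c q₀).powersetCard (D + 1)

omit [TopologicalSpace G] [IsTopologicalGroup G] [CompactSpace G] [MeasurableSpace G] [BorelSpace G] in
/-- A member of the choice set is a `(D+1)`-subset of the cell's plaquettes. -/
theorem subset_card_of_mem_ballChoices {w : Fin 4 → ℤ → ℤ} {R D : ℕ} {c : Fin 4 → ℤ} {Q : Finset (ZdPlaquette 4)}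
    (hQ : Q ∈ ballChoices w R D c) : Q ⊆ cellPlaqs w c ∧ #Q = D + 1 := by
  obtain ⟨q₀, _, hQ⟩ := Finset.mem_biUnion.1 hQ
  obtain ⟨hsub, hcard⟩ := Finset.mem_powersetCard.1 hQ
  exact ⟨hsub.trans (Finset.filter_subset _ _), hcard⟩

omit [TopologicalSpace G] [IsTopologicalGroup G] [CompactSpace G] [MeasurableSpace G] [BorelSpace G] in
/-- **An atypical configuration exhibits `D+1` large-field plaquettes forming a member of the choice set.**  (Take for
`X` the set of ALL `t₀`-large plaquettes of the cell: the configuration is small-field off `X`, so `U ∉ Typ_bs` forces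
`X` to be non-sparse — some `R`-ball holds `D+1` of them, and they lie within `2R` of any one of them.) -/
theorem exists_mem_ballChoices_of_notMem {w : Fin 4 → ℤ → ℤ} {t₀ : ℝ} {R D : ℕ} {c : Fin 4 → ℤ} {U : LGConfig 4 G}
    (hU : U ∉ typBallSparse ρ w t₀ R D c) :
    ∃ Q ∈ ballChoices w R D c, ∀ p ∈ Q, t₀ < (N : ℝ) - plaquetteObs ρ p.1 p.2.1.1 p.2.1.2 U := by
  classical
  set X : Finset (ZdPlaquette 4) :=
    (cellPlaqs w c).filter fun p => t₀ < (N : ℝ) - plaquetteObs ρ p.1 p.2.1.1 p.2.1.2 U with hX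
  have hXsub : X ⊆ cellPlaqs w c := Finset.filter_subset _ _
  have hsf : U ∈ smallFieldRegion ρ (↑(cellPlaqs w c \ X) : Set (ZdPlaquette 4)) t₀ := by
    intro p hp
    obtain ⟨hp1, hp2⟩ := Finset.mem_sdiff.1 (Finset.mem_coe.1 hp)
    by_contra h
    exact hp2 (Finset.mem_filter.2 ⟨hp1, lt_of_not_ge h⟩)
  have hns : ¬ IsBallSparse R D X := fun h => hU ⟨X, hXsub, h, hsf⟩
  simp only [IsBallSparse, not_forall, not_le] at hns
  obtain ⟨x, hx⟩ := hns
  set B : Finset (ZdPlaquette 4) := X.filter fun p => ∀ i, |p.1 i - x i| ≤ (R : ℤ) with hB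
  obtain ⟨Q, hQB, hQcard⟩ := Finset.exists_subset_card_eq (show D + 1 ≤ #B by omega)
  have hQne : Q.Nonempty := by rw [← Finset.card_pos, hQcard]; omega
  obtain ⟨q₀, hq₀⟩ := hQne
  have hBX : B ⊆ X := Finset.filter_subset _ _
  refine ⟨Q, Finset.mem_biUnion.2 ⟨q₀, hXsub (hBX (hQB hq₀)), Finset.mem_powersetCard.2 ⟨?_, hQcard⟩⟩, ?_⟩
  · intro p hp
    refine Finset.mem_filter.2 ⟨hXsub (hBX (hQB hp)), fun i => ?_⟩
    have h1 : |p.1 i - x i| ≤ (R : ℤ) := (Finset.mem_filter.1 (hQB hp)).2 i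
    have h2 : |q₀.1 i - x i| ≤ (R : ℤ) := (Finset.mem_filter.1 (hQB hq₀)).2 i
    calc |p.1 i - q₀.1 i| ≤ |p.1 i - x i| + |x i - q₀.1 i| := abs_sub_le _ _ _
      _ ≤ (R : ℤ) + (R : ℤ) := by rw [abs_sub_comm (x i)]; exact add_le_add h1 h2
      _ = 2 * (R : ℤ) := by ring
  · intro p hp
    exact (Finset.mem_filter.1 (hBX (hQB hp))).2

omit [TopologicalSpace G] [IsTopologicalGroup G] [CompactSpace G] [MeasurableSpace G] [BorelSpace G] in
/-- A `2R`-sup-ball holds at most `(4R+1)⁴ · m` plaquettes (`m = #orientations`). -/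
theorem card_nearPlaqs_le (w : Fin 4 → ℤ → ℤ) (R : ℕ) (c : Fin 4 → ℤ) (q₀ : ZdPlaquette 4) :
    #(nearPlaqs w R c q₀) ≤ (4 * R + 1) ^ 4 * Fintype.card (Orient 4) := by
  classical
  have hsub : nearPlaqs w R c q₀ ⊆
      (Fintype.piFinset fun i : Fin 4 => Finset.Icc (q₀.1 i - 2 * (R : ℤ)) (q₀.1 i + 2 * (R : ℤ))) ×ˢ
        (Finset.univ : Finset (Orient 4)) := by
    intro p hp
    have hp' := (Finset.mem_filter.1 hp).2
    refine Finset.mem_product.2 ⟨Fintype.mem_piFinset.2 fun i => Finset.mem_Icc.2 ?_, Finset.mem_univ _⟩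
    have := abs_le.1 (hp' i)
    constructor <;> omega
  refine (Finset.card_le_card hsub).trans ?_
  rw [Finset.card_product, Finset.card_univ, Fintype.card_piFinset]
  refine Nat.mul_le_mul_right _ ?_
  have h : ∀ i : Fin 4, #(Finset.Icc (q₀.1 i - 2 * (R : ℤ)) (q₀.1 i + 2 * (R : ℤ))) ≤ 4 * R + 1 := fun i => by
    rw [Int.card_Icc]
    refine Int.toNat_le.2 ?_
    push_cast
    omega
  calc ∏ i : Fin 4, #(Finset.Icc (q₀.1 i - 2 * (R : ℤ)) (q₀.1 i + 2 * (R : ℤ))) ≤ ∏ _i : Fin 4, (4 * R + 1) :=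
      Finset.prod_le_prod' fun i _ => h i
    _ = (4 * R + 1) ^ 4 := by rw [Finset.prod_const, Finset.card_univ, Fintype.card_fin]

omit [TopologicalSpace G] [IsTopologicalGroup G] [CompactSpace G] [MeasurableSpace G] [BorelSpace G] in
/-- **The size of the choice set**: `#ballChoices w R D c ≤ (2b)⁴ m · ((4R+1)⁴ m)^(D+1)` for a cell of a mesh-`b` grid. -/
theorem card_ballChoices_le {w : Fin 4 → ℤ → ℤ} {b : ℕ}
    (hw : ∀ i j, w i j + ((b : ℕ) : ℤ) ≤ w i (j + 1) ∧ w i (j + 1) ≤ w i j + 2 * ((b : ℕ) : ℤ))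
    (R D : ℕ) (c : Fin 4 → ℤ) :
    #(ballChoices w R D c) ≤
      ((2 * b) ^ 4 * Fintype.card (Orient 4)) * ((4 * R + 1) ^ 4 * Fintype.card (Orient 4)) ^ (D + 1) := by
  classical
  unfold ballChoices
  refine Finset.card_biUnion_le.trans ?_
  calc ∑ q₀ ∈ cellPlaqs w c, #((nearPlaqs w R c q₀).powersetCard (D + 1))
      ≤ ∑ _q₀ ∈ cellPlaqs w c, ((4 * R + 1) ^ 4 * Fintype.card (Orient 4)) ^ (D + 1) := by
        refine Finset.sum_le_sum fun q₀ _ => ?_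
        rw [Finset.card_powersetCard]
        exact (Nat.choose_le_pow _ _).trans (Nat.pow_le_pow_left (card_nearPlaqs_le w R c q₀) _)
    _ = #(cellPlaqs w c) * ((4 * R + 1) ^ 4 * Fintype.card (Orient 4)) ^ (D + 1) := by
        rw [Finset.sum_const, smul_eq_mul]
    _ ≤ ((2 * b) ^ 4 * Fintype.card (Orient 4)) * ((4 * R + 1) ^ 4 * Fintype.card (Orient 4)) ^ (D + 1) :=
        Nat.mul_le_mul_right _ (card_cellPlaqs_le hw c)

end Choices

/-! ### §3. The torus anchor (clause (iii_T)) for the ball-sparse factor -/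

omit [TopologicalSpace G] [IsTopologicalGroup G] [CompactSpace G] [MeasurableSpace G] [BorelSpace G] in
/-- The torus cost of a projected plaquette is the `ℤ⁴` plaquette cost read on the periodic lift. -/
theorem plaquetteCost_projPlaq {N : ℕ} (ρ : G →* Matrix (Fin N) (Fin N) ℂ) (S : ℕ)
    (V : GaugeConfig 4 (2 * S + 1) G) (q : ZdPlaquette 4) :
    plaquetteCost ρ V (projPlaq (2 * S + 1) q) =
      (N : ℝ) - plaquetteObs ρ q.1 q.2.1.1 q.2.1.2 (torusLift (2 * S + 1) V) := by
  rw [plaquetteObs, FreeEnergy.plaquetteHolonomyZd_torusLift]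
  rfl

/-- **The torus anchor (clause (iii_T) of `TypShellCond`) for the ball-sparse small-field factor.**  For every lattice
representation `r : LatticeRep G` there are `K₀, D₁` (those of `measureReal_forall_le_cellAction_le_pow_rep`) such that
for all `β ≥ 1`, `0 ≤ λ ≤ β`, meshes `b ≥ 1`, thresholds `t₀`, radii `R`, multiplicities `D`, every mesh-`b` grid `w`,
every odd torus `2S+1 ≥ 4b` and every finite set `F` of cells inside `[-S, S]⁴`:
`μ_{2S+1,β} {V | ∀ c ∈ F, torusLift V ∉ typBallSparse r.ρ w t₀ R D c} ≤ ofReal (δ_bs ^ #F)`,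
`δ_bs = (2b)⁴ m · ((4R+1)⁴ m)^(D+1) · m · exp (-λ (t₀ (D+1)) / m² + (D+1) (K₀ + D₁ log β) / m)`, `m = #orientations`.
Proof: an atypical cell has a member of `ballChoices` all of whose `D+1` plaquettes are `t₀`-large
(`exists_mem_ballChoices_of_notMem`), hence torus cell action `≥ t₀ (D+1)` on the projected subset; union over
`F.pi ballChoices` (`card_ballChoices_le`, `Finset.card_pi`) of the hereditary chessboard rarity
`measureReal_forall_le_cellAction_le_pow_rep` (distinct cells of the grid have disjoint plaquette sets, which project
injectively from `[-S, S]⁴`). -/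
theorem torusAnchor_typBallSparse (r : LatticeRep G) :
    ∃ K₀ : ℝ, ∃ D₁ : ℕ, ∀ (β : ℝ), 1 ≤ β → ∀ (lam : ℝ), 0 ≤ lam → lam ≤ β → ∀ (b : ℕ), 1 ≤ b →
      ∀ (t₀ : ℝ) (R D : ℕ) (w : Fin 4 → ℤ → ℤ),
        (∀ i j, w i j + ((b : ℕ) : ℤ) ≤ w i (j + 1) ∧ w i (j + 1) ≤ w i j + 2 * ((b : ℕ) : ℤ)) →
          ∀ S : ℕ, 4 * b ≤ 2 * S + 1 → ∀ F : Finset (Fin 4 → ℤ),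
            (∀ c ∈ F, ∀ i, -(S : ℤ) ≤ w i (c i) ∧ w i (c i + 1) ≤ (S : ℤ) + 1) →
              (wilsonMeasure (d := 4) (L := 2 * S + 1) r.ρ β)
                  {V : GaugeConfig 4 (2 * S + 1) G |
                    ∀ c ∈ F, torusLift (2 * S + 1) V ∉ typBallSparse r.ρ w t₀ R D c} ≤
                ENNReal.ofReal
                  (((((2 * b) ^ 4 * Fintype.card (Orient 4) : ℕ) : ℝ) *
                      ((((4 * R + 1) ^ 4 * Fintype.card (Orient 4) : ℕ) : ℝ) ^ (D + 1)) *
                    ((Fintype.card (Orient 4) : ℝ) *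
                      Real.exp (-(lam * (t₀ * (D + 1))) / (Fintype.card (Orient 4) : ℝ) ^ 2 +
                        ((D + 1 : ℕ) : ℝ) * (K₀ + D₁ * Real.log β) / Fintype.card (Orient 4)))) ^ #F) := by
  classical
  obtain ⟨K₀, D₁, h⟩ := measureReal_forall_le_cellAction_le_pow_rep r
  refine ⟨K₀, D₁, fun β hβ lam hlam hlamβ b hb t₀ R D w hw S hS F hin => ?_⟩
  have hL : Odd (2 * S + 1) := ⟨S, rfl⟩
  have hL3 : 3 ≤ 2 * S + 1 := by omega
  haveI := isProbabilityMeasure_wilsonMeasure (d := 4) (L := 2 * S + 1) (G := G) r.ρ r.continuous β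
  set μ := wilsonMeasure (d := 4) (L := 2 * S + 1) (G := G) r.ρ β with hμ
  obtain ⟨M, hM⟩ : ∃ M : ℕ, M = ((2 * b) ^ 4 * Fintype.card (Orient 4)) *
      ((4 * R + 1) ^ 4 * Fintype.card (Orient 4)) ^ (D + 1) := ⟨_, rfl⟩
  obtain ⟨δ₀, hδ₀⟩ : ∃ δ₀ : ℝ, δ₀ = (Fintype.card (Orient 4) : ℝ) *
      Real.exp (-(lam * (t₀ * (D + 1))) / (Fintype.card (Orient 4) : ℝ) ^ 2 +
        ((D + 1 : ℕ) : ℝ) * (K₀ + D₁ * Real.log β) / Fintype.card (Orient 4)) := ⟨_, rfl⟩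
  have hδ₀nn : 0 ≤ δ₀ := by rw [hδ₀]; positivity
  -- the torus plaquette families of a choice function and the corresponding events
  set Pf : (∀ c ∈ F, Finset (ZdPlaquette 4)) → (Fin 4 → ℤ) → Finset (Plaquette 4 (2 * S + 1)) :=
    fun f c => if hc : c ∈ F then (f c hc).image (projPlaq (2 * S + 1)) else ∅ with hPf
  set E : (∀ c ∈ F, Finset (ZdPlaquette 4)) → Set (GaugeConfig 4 (2 * S + 1) G) :=
    fun f => {V | ∀ c ∈ F, t₀ * (D + 1) ≤ ∑ q ∈ Pf f c, plaquetteCost r.ρ V q} with hE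
  -- Step 1: the atypical event is covered by the events of the choice functions
  have hcover : {V : GaugeConfig 4 (2 * S + 1) G |
      ∀ c ∈ F, torusLift (2 * S + 1) V ∉ typBallSparse r.ρ w t₀ R D c} ⊆
        ⋃ f ∈ F.pi (ballChoices w R D), E f := by
    intro V hV
    simp only [Set.mem_setOf_eq] at hV
    choose Q hQmem hQlarge using
      fun c (hc : c ∈ F) => exists_mem_ballChoices_of_notMem (G := G) r.ρ (hV c hc)
    refine Set.mem_iUnion₂.2 ⟨Q, Finset.mem_pi.2 fun c hc => hQmem c hc, ?_⟩
    simp only [hE, Set.mem_setOf_eq]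
    intro c hc
    obtain ⟨hQsub, hQcard⟩ := subset_card_of_mem_ballChoices (hQmem c hc)
    simp only [hPf, dif_pos hc]
    rw [Finset.sum_image fun q hq q' hq' hqq => projPlaq_injOn_box S
      (cellSites_subset_box (hin c hc) _ (fst_mem_cellSites_of_mem_cellPlaqs (hQsub hq)))
      (cellSites_subset_box (hin c hc) _ (fst_mem_cellSites_of_mem_cellPlaqs (hQsub hq'))) hqq]
    have hsum : #(Q c hc) • t₀ ≤ ∑ p ∈ Q c hc, plaquetteCost r.ρ V (projPlaq (2 * S + 1) p) :=
      Finset.card_nsmul_le_sum _ _ _ fun p hp => by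
        rw [plaquetteCost_projPlaq]
        exact (hQlarge c hc p hp).le
    rw [hQcard, nsmul_eq_mul] at hsum
    push_cast at hsum
    linarith
  -- Step 2: each choice function's event is hereditarily rare
  have hstep : ∀ f ∈ F.pi (ballChoices w R D), μ (E f) ≤ ENNReal.ofReal (δ₀ ^ #F) := by
    intro f hf
    have hf' : ∀ c (hc : c ∈ F), f c hc ∈ ballChoices w R D c := Finset.mem_pi.1 hf
    have hdisj : ∀ c ∈ F, ∀ c' ∈ F, c ≠ c' → Disjoint (Pf f c) (Pf f c') := by
      intro c hc c' hc' hcc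
      simp only [hPf, dif_pos hc, dif_pos hc']
      rw [Finset.disjoint_left]
      intro q hq hq'
      obtain ⟨z, hz, rfl⟩ := Finset.mem_image.1 hq
      obtain ⟨z', hz', hzz⟩ := Finset.mem_image.1 hq'
      have hzc : z ∈ cellPlaqs w c := (subset_card_of_mem_ballChoices (hf' c hc)).1 hz
      have hz'c : z' ∈ cellPlaqs w c' := (subset_card_of_mem_ballChoices (hf' c' hc')).1 hz'
      have hz1 := fst_mem_cellSites_of_mem_cellPlaqs hzc
      have hz'1 := fst_mem_cellSites_of_mem_cellPlaqs hz'c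
      have heq : z' = z := projPlaq_injOn_box S (cellSites_subset_box (hin c' hc') _ hz'1)
        (cellSites_subset_box (hin c hc) _ hz1) hzz
      rw [heq] at hz'1
      exact Finset.disjoint_left.1 (disjoint_cellSites hw hcc) hz1 hz'1
    have hn : ∀ c ∈ F, #(Pf f c) ≤ D + 1 := by
      intro c hc
      simp only [hPf, dif_pos hc]
      exact Finset.card_image_le.trans (subset_card_of_mem_ballChoices (hf' c hc)).2.le
    have hmain := h hL hL3 β hβ lam hlam hlamβ F (Pf f) hdisj (D + 1) hn (t₀ * (D + 1))
    rw [← ofReal_measureReal, hδ₀]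
    exact ENNReal.ofReal_le_ofReal hmain
  -- Step 3: the union bound
  have hcardpi : (#(F.pi (ballChoices w R D)) : ℝ) ≤ (M : ℝ) ^ #F := by
    rw [Finset.card_pi]
    have : ∏ c ∈ F, #(ballChoices w R D c) ≤ ∏ _c ∈ F, M :=
      Finset.prod_le_prod' fun c _ => hM ▸ card_ballChoices_le hw R D c
    rw [Finset.prod_const] at this
    exact_mod_cast this
  calc μ {V : GaugeConfig 4 (2 * S + 1) G | ∀ c ∈ F, torusLift (2 * S + 1) V ∉ typBallSparse r.ρ w t₀ R D c}
      ≤ μ (⋃ f ∈ F.pi (ballChoices w R D), E f) := measure_mono hcover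
    _ ≤ ∑ f ∈ F.pi (ballChoices w R D), μ (E f) := measure_biUnion_finset_le _ _
    _ ≤ ∑ _f ∈ F.pi (ballChoices w R D), ENNReal.ofReal (δ₀ ^ #F) := Finset.sum_le_sum hstep
    _ = (#(F.pi (ballChoices w R D)) : ENNReal) * ENNReal.ofReal (δ₀ ^ #F) := by
        rw [Finset.sum_const, nsmul_eq_mul]
    _ ≤ ENNReal.ofReal ((M : ℝ) ^ #F) * ENNReal.ofReal (δ₀ ^ #F) := by
        gcongr
        rw [← ENNReal.ofReal_natCast]
        exact ENNReal.ofReal_le_ofReal hcardpi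
    _ = ENNReal.ofReal (((M : ℝ) * δ₀) ^ #F) := by
        rw [← ENNReal.ofReal_mul (by positivity), mul_pow]
    _ = _ := by
        rw [hM, hδ₀]
        push_cast
        ring

end Summit.QuantumFields.YangMills.Theorems.OddTorusChessboard

end
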